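import Literature.NumberTheory.GaloisRepresentations.PeriodRingDataCharacter
import Literature.NumberTheory.GaloisRepresentations.PotentialDiagonalizabilityCriteriaProofs
import HarnessLib

/-!
# Twisting a `B`-admissible representation by a character with a period

Generic `p`-adic Hodge theory for an arbitrary period-ring datum `𝔅 : PeriodRingData Γ P E`
(accepted `PAdicHodge`: a Fontaine-regular `(P, Γ)`-ring `B` with `B^Γ = E`), continuing the
accepted `PeriodRingDataCharacter` (rank one: a character `χ` is `𝔅`-admissible as soon as it has
ONE nonzero period `s ∈ B`, `χ(σ)·σ(s) = s`).  Main results — all [folklore] instances of Fontaine,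
Astérisque 223, Exp. III, Prop. 1.5.2 ("the category of `B`-admissible representations is stable
under `⊗` and duals"), in the special case of a tensor product with a CHARACTER, which is the case the
route files need (Tate twists `ρ ⊗ χ_cyc^k`):

* `exists_period_of_isAdmissible` — conversely, an admissible character HAS a nonzero period
  (`dim_E D_B(χ) = 1`).
* `period_mul`, `exists_period_inv` — periods multiply, and the period of an admissible character is
  a unit of `B` (regularity (iii)) whose inverse is a period of `χ⁻¹`; hence
  `isAdmissible_of_chi_mul`, `isAdmissible_of_chi_inv`: **the `𝔅`-admissible `P`-valued characters
  form a group**.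
* `isAdmissible_of_twist_period` — **twist stability**: if `ρ₁` on `V` is admissible and `ρ₂` on the
  same space is `ρ₂(σ) = θ(σ) ρ₁(σ)` for a scalar function `θ : Γ → P` admitting a nonzero period
  `s` (`θ(σ)·σ(s) = s`), then `ρ₂` is admissible: multiplication by `s` is an `E`-linear injection
  `D_B(V, ρ₁) ↪ D_B(V, ρ₂)` (`smul_mem_D_of_period`), and Fontaine's inequality
  (`finrank_D_le_holds`) closes the count.  With `exists_period_of_isAdmissible`:
  `isAdmissible_of_twist` (twist by an ADMISSIBLE character).

No named facts, no new definitions.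

## References
* [FontaineAsterisque223III] J.-M. Fontaine, *Représentations p-adiques semi-stables*,
  Astérisque 223 (1994), Exp. III, §1.4 (regular rings), Prop. 1.5.2 (stability under `⊗`, duals).
* [FontaineOuyang2022] J.-M. Fontaine, Y. Ouyang, *Theory of p-adic Galois representations*,
  Thm. 2.13 (2), §5.1.
-/

noncomputable section

open scoped TensorProduct

namespace Literature.NumberTheory.GaloisRepresentations

namespace PeriodRingData

-- Mathlib's own global value of `maxSynthPendingDepth` (the project default `1` makes nested
-- instance problems on `𝔅.B ⊗[P] M` fail spuriously; see the note in `PAdicHodgeProofs`).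
set_option maxSynthPendingDepth 3

universe u v v' w w'

variable {Γ : Type u} [Group Γ] [TopologicalSpace Γ] {P : Type v} {E : Type v'} [Field P]
  [TopologicalSpace P] [Field E] [Algebra P E]
  {M : Type w'} [AddCommGroup M] [Module P M] [TopologicalSpace M]
  (𝔅 : PeriodRingData.{u, v, v', w} Γ P E)

/-! ### 1. Periods of characters -/

/-- **An admissible character has a nonzero period.**  If the rank-one representation
`ρ : Γ → GL_1(P)` with character `χ = PeriodRingData.chi ρ` is `𝔅`-admissible, then some `s ∈ B`,
`s ≠ 0`, satisfies `χ(σ)·σ(s) = s` for all `σ` (`D_B(χ) ≅ Dtw` is a line, accepted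
`finrank_D_eq`). [cite: FontaineAsterisque223III, Exp. III §1.5] -/
theorem exists_period_of_isAdmissible (ρ : ContinuousRep Γ P P) (h : 𝔅.IsAdmissible ρ) :
    ∃ s : 𝔅.B, s ≠ 0 ∧ ∀ σ : Γ, algebraMap P 𝔅.B (chi ρ σ) * σ • s = s := by
  have h1 : Module.finrank E (𝔅.Dtw ρ) = 1 := by
    rw [← finrank_D_eq]
    exact h.trans (Module.finrank_self P)
  have hne : 𝔅.Dtw ρ ≠ ⊥ := fun hbot => by
    rw [hbot, finrank_bot] at h1
    exact zero_ne_one h1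
  obtain ⟨s, hs, hs0⟩ := Submodule.exists_mem_ne_zero_of_ne_bot hne
  exact ⟨s, hs0, (𝔅.mem_Dtw_iff ρ).1 hs⟩

omit [TopologicalSpace Γ] [TopologicalSpace P] in
/-- **Periods multiply**: a period of `θ` times a period of `θ'` is a period of `θθ'`. [folklore] -/
theorem period_mul {θ θ' : Γ → P} {s s' : 𝔅.B}
    (hs : ∀ σ : Γ, algebraMap P 𝔅.B (θ σ) * σ • s = s)
    (hs' : ∀ σ : Γ, algebraMap P 𝔅.B (θ' σ) * σ • s' = s') :
    ∀ σ : Γ, algebraMap P 𝔅.B (θ σ * θ' σ) * σ • (s * s') = s * s' := fun σ => by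
  rw [map_mul, smul_mul', mul_mul_mul_comm, hs σ, hs' σ]

omit [TopologicalSpace Γ] [TopologicalSpace P] in
/-- A function with a nonzero period does not vanish. [folklore] -/
theorem ne_zero_of_period {θ : Γ → P} {s : 𝔅.B} (hs0 : s ≠ 0)
    (hs : ∀ σ : Γ, algebraMap P 𝔅.B (θ σ) * σ • s = s) (σ : Γ) : θ σ ≠ 0 := fun h0 =>
  hs0 (by rw [← hs σ, h0, map_zero, zero_mul])

omit [TopologicalSpace Γ] [TopologicalSpace P] in
/-- **A nonzero period is a unit** (Fontaine's regularity (iii): the `P`-line through `s` is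
`Γ`-stable, `σ(s) = θ(σ)⁻¹ s`). [cite: FontaineAsterisque223III, Exp. III §1.4] -/
theorem isUnit_of_period {θ : Γ → P} {s : 𝔅.B} (hs0 : s ≠ 0)
    (hs : ∀ σ : Γ, algebraMap P 𝔅.B (θ σ) * σ • s = s) : IsUnit s := by
  refine 𝔅.isUnit_of_smul_mem s hs0 fun σ => ⟨(θ σ)⁻¹, ?_⟩
  have hθ := 𝔅.ne_zero_of_period hs0 hs σ
  rw [← algebraMap_eq]
  apply mul_left_cancel₀ ((map_ne_zero (algebraMap P 𝔅.B)).2 hθ)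
  rw [hs σ, ← mul_assoc, ← map_mul, mul_inv_cancel₀ hθ, map_one, one_mul]

omit [TopologicalSpace Γ] [TopologicalSpace P] in
/-- **Periods invert**: the inverse of a nonzero period of `θ` is a (nonzero) period of `θ⁻¹`.
[cite: FontaineAsterisque223III, Exp. III Prop. 1.5.2] -/
theorem exists_period_inv {θ : Γ → P} {s : 𝔅.B} (hs0 : s ≠ 0)
    (hs : ∀ σ : Γ, algebraMap P 𝔅.B (θ σ) * σ • s = s) :
    ∃ s' : 𝔅.B, s' ≠ 0 ∧ s * s' = 1 ∧ ∀ σ : Γ, algebraMap P 𝔅.B (θ σ)⁻¹ * σ • s' = s' := by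
  have hθ := 𝔅.ne_zero_of_period hs0 hs
  obtain ⟨u, rfl⟩ := 𝔅.isUnit_of_period hs0 hs
  refine ⟨↑u⁻¹, Units.ne_zero _, u.mul_inv, fun σ => ?_⟩
  have h1 : (σ • (u : 𝔅.B)) * (σ • (↑u⁻¹ : 𝔅.B)) = 1 := by
    rw [← smul_mul', Units.mul_inv, smul_one]
  calc algebraMap P 𝔅.B (θ σ)⁻¹ * σ • (↑u⁻¹ : 𝔅.B)
      = algebraMap P 𝔅.B (θ σ)⁻¹ * σ • (↑u⁻¹ : 𝔅.B) *
          (algebraMap P 𝔅.B (θ σ) * σ • (u : 𝔅.B)) * ↑u⁻¹ := by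
        rw [hs σ, mul_assoc, Units.mul_inv, mul_one]
    _ = (algebraMap P 𝔅.B (θ σ)⁻¹ * algebraMap P 𝔅.B (θ σ)) *
          ((σ • (u : 𝔅.B)) * (σ • (↑u⁻¹ : 𝔅.B))) * ↑u⁻¹ := by ring
    _ = ↑u⁻¹ := by rw [← map_mul, inv_mul_cancel₀ (hθ σ), map_one, one_mul, h1, one_mul]

/-- **Admissible characters are closed under products**: if `χ(ρ'') = χ(ρ) χ(ρ')` pointwise and
`ρ, ρ'` are `𝔅`-admissible, so is `ρ''`. [cite: FontaineAsterisque223III, Exp. III Prop. 1.5.2] -/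
theorem isAdmissible_of_chi_mul (ρ ρ' ρ'' : ContinuousRep Γ P P)
    (h : ∀ σ : Γ, chi ρ'' σ = chi ρ σ * chi ρ' σ)
    (hρ : 𝔅.IsAdmissible ρ) (hρ' : 𝔅.IsAdmissible ρ') : 𝔅.IsAdmissible ρ'' := by
  obtain ⟨s, hs0, hs⟩ := 𝔅.exists_period_of_isAdmissible ρ hρ
  obtain ⟨s', hs0', hs'⟩ := 𝔅.exists_period_of_isAdmissible ρ' hρ'
  refine isAdmissible_of_period (s := s * s') (mul_ne_zero hs0 hs0') fun σ => ?_
  rw [h σ]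
  exact 𝔅.period_mul hs hs' σ

/-- **Admissible characters are closed under inverses**: if `χ(ρ') = χ(ρ)⁻¹` pointwise and `ρ` is
`𝔅`-admissible, so is `ρ'`. [cite: FontaineAsterisque223III, Exp. III Prop. 1.5.2] -/
theorem isAdmissible_of_chi_inv (ρ ρ' : ContinuousRep Γ P P)
    (h : ∀ σ : Γ, chi ρ' σ = (chi ρ σ)⁻¹) (hρ : 𝔅.IsAdmissible ρ) : 𝔅.IsAdmissible ρ' := by
  obtain ⟨s, hs0, hs⟩ := 𝔅.exists_period_of_isAdmissible ρ hρ
  obtain ⟨s', hs0', -, hs'⟩ := 𝔅.exists_period_inv hs0 hs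
  refine isAdmissible_of_period (s := s') hs0' fun σ => ?_
  rw [h σ]
  exact hs' σ

/-! ### 2. Twisting an admissible representation by a character with a period -/

/-- If `ρ₂(σ) = θ(σ) ρ₁(σ)` then the diagonal actions on `B ⊗_P V` differ by the scalar `θ(σ)`.
[folklore] -/
theorem tensorRep_apply_of_smul (ρ₁ ρ₂ : ContinuousRep Γ P M) (θ : Γ → P)
    (h : ∀ (σ : Γ) (m : M), ρ₂ σ m = θ σ • ρ₁ σ m) (σ : Γ) (x : 𝔅.B ⊗[P] M) :
    𝔅.tensorRep ρ₂ σ x = θ σ • 𝔅.tensorRep ρ₁ σ x := by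
  induction x using TensorProduct.induction_on with
  | zero => rw [map_zero, map_zero, smul_zero]
  | tmul b m => rw [tensorRep_apply_tmul, tensorRep_apply_tmul, h σ m, TensorProduct.tmul_smul]
  | add x y hx hy => rw [map_add, map_add, hx, hy, smul_add]

/-- **Multiplication by a period of `θ` maps `D_B(V, ρ₁)` into `D_B(V, θ ρ₁)`.** [folklore] -/
theorem smul_mem_D_of_period (ρ₁ ρ₂ : ContinuousRep Γ P M) (θ : Γ → P)
    (h : ∀ (σ : Γ) (m : M), ρ₂ σ m = θ σ • ρ₁ σ m) {s : 𝔅.B}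
    (hs : ∀ σ : Γ, algebraMap P 𝔅.B (θ σ) * σ • s = s) {x : 𝔅.B ⊗[P] M} (hx : x ∈ 𝔅.D ρ₁) :
    s • x ∈ 𝔅.D ρ₂ := by
  rw [mem_D_iff] at hx ⊢
  intro σ
  rw [𝔅.tensorRep_apply_of_smul ρ₁ ρ₂ θ h, tensorRep_apply_smul, hx σ, ← smul_assoc,
    Algebra.smul_def, hs σ]

/-- **Twist stability of admissibility (character with a period).**  Let `ρ₁` be a `𝔅`-admissible
representation on the finite-dimensional `V`, and `ρ₂` the representation `σ ↦ θ(σ) ρ₁(σ)` on the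
same space, for a scalar function `θ : Γ → P` admitting a nonzero period `s ∈ B`
(`θ(σ)·σ(s) = s`).  Then `ρ₂` is `𝔅`-admissible: `x ↦ s·x` is an `E`-linear injection
`D_B(V, ρ₁) ↪ D_B(V, ρ₂)` (`B ⊗_P V` is a free module over the domain `B`), so
`dim V = dim D(ρ₁) ≤ dim D(ρ₂) ≤ dim V` by Fontaine's inequality.
[cite: FontaineAsterisque223III, Exp. III Prop. 1.5.2] [cite: FontaineOuyang2022, Thm. 2.13] -/
theorem isAdmissible_of_twist_period [FiniteDimensional P M] (ρ₁ ρ₂ : ContinuousRep Γ P M)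
    (θ : Γ → P) (h : ∀ (σ : Γ) (m : M), ρ₂ σ m = θ σ • ρ₁ σ m) {s : 𝔅.B} (hs0 : s ≠ 0)
    (hs : ∀ σ : Γ, algebraMap P 𝔅.B (θ σ) * σ • s = s) (h1 : 𝔅.IsAdmissible ρ₁) :
    𝔅.IsAdmissible ρ₂ := by
  classical
  haveI := 𝔅.finite_D ρ₂
  let L : 𝔅.D ρ₁ →ₗ[E] 𝔅.D ρ₂ :=
    { toFun := fun x => ⟨s • (x : 𝔅.B ⊗[P] M), 𝔅.smul_mem_D_of_period ρ₁ ρ₂ θ h hs x.2⟩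
      map_add' := fun x y => Subtype.ext (smul_add s (x : 𝔅.B ⊗[P] M) y)
      map_smul' := fun e x => Subtype.ext (smul_comm s e (x : 𝔅.B ⊗[P] M)) }
  have hL : Function.Injective L := fun x y hxy =>
    Subtype.ext (smul_right_injective _ hs0 (congrArg Subtype.val hxy))
  have h2 := LinearMap.finrank_le_finrank_of_injective hL
  have h3 : Module.finrank E (𝔅.D ρ₂) ≤ Module.finrank P M := 𝔅.finrank_D_le_holds ρ₂
  unfold IsAdmissible at h1 ⊢
  omega

/-- **Twist stability of admissibility (admissible character).**  If `ρ₁` on the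
finite-dimensional `V` is `𝔅`-admissible, `χ : Γ → GL_1(P)` is a `𝔅`-admissible character, and
`ρ₂(σ) = χ(σ) ρ₁(σ)` on `V`, then `ρ₂` is `𝔅`-admissible — Fontaine's `⊗`-stability for
`V ⊗ P(χ)`. [cite: FontaineAsterisque223III, Exp. III Prop. 1.5.2] -/
theorem isAdmissible_of_twist [FiniteDimensional P M] (ρ₁ ρ₂ : ContinuousRep Γ P M)
    (χ : ContinuousRep Γ P P) (h : ∀ (σ : Γ) (m : M), ρ₂ σ m = chi χ σ • ρ₁ σ m)
    (hχ : 𝔅.IsAdmissible χ) (h1 : 𝔅.IsAdmissible ρ₁) : 𝔅.IsAdmissible ρ₂ := by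
  obtain ⟨s, hs0, hs⟩ := 𝔅.exists_period_of_isAdmissible χ hχ
  exact 𝔅.isAdmissible_of_twist_period ρ₁ ρ₂ (chi χ) h hs0 hs h1

/-- … and conversely `ρ₁` is admissible if its twist `ρ₂` is (twist back by `χ⁻¹`, whose period is
the inverse unit). [cite: FontaineAsterisque223III, Exp. III Prop. 1.5.2] -/
theorem isAdmissible_iff_of_twist [FiniteDimensional P M] (ρ₁ ρ₂ : ContinuousRep Γ P M)
    (χ : ContinuousRep Γ P P) (h : ∀ (σ : Γ) (m : M), ρ₂ σ m = chi χ σ • ρ₁ σ m)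
    (hχ : 𝔅.IsAdmissible χ) : 𝔅.IsAdmissible ρ₁ ↔ 𝔅.IsAdmissible ρ₂ := by
  refine ⟨𝔅.isAdmissible_of_twist ρ₁ ρ₂ χ h hχ, fun h2 => ?_⟩
  obtain ⟨s, hs0, hs⟩ := 𝔅.exists_period_of_isAdmissible χ hχ
  obtain ⟨s', hs0', -, hs'⟩ := 𝔅.exists_period_inv hs0 hs
  refine 𝔅.isAdmissible_of_twist_period ρ₂ ρ₁ (fun σ => (chi χ σ)⁻¹) (fun σ m => ?_) hs0' hs' h2
  rw [h σ m, smul_smul, inv_mul_cancel₀ (chi_ne_zero χ σ), one_smul]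

end PeriodRingData

end Literature.NumberTheory.GaloisRepresentations

end
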